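import Literature.NumberTheory.PAdicHodge.KummerCocycleMatchingO
import HarnessLib

/-!
# K1 for `𝒪_D`-rational points in the Kummer theory of `E`: fixed lifts supplied, the index step `E(F) ⊋ E₁(F)`, the K★ cells

Topic `Literature/NumberTheory/PAdicHodge`; namespaces `Literature.NumberTheory.GaloisRepresentations.PeriodRingData` (§1) and
`Literature.NumberTheory.PAdicHodge.AinfTop` (§§2–5). THEOREMS ONLY (no definition, no named fact, no instance, no `sorry`).
Sequel of `KummerCocycleMatchingO` (★★ `isFilZeroCoboundary_kummerO_curveFO`: K1 for the algebraic Kummer cocycle `σ ↦ 1 ⊗ (σQₙ − Qₙ)ₙ`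
of a `p`-power division sequence `Q` of a `Γ_F`-fixed formal point `Q₀` whose parameter has a `Γ_F`-fixed lift to `Ŵ(𝔫_𝒪)`), removing
the bookkeeping hypotheses one by one:

* §1 `IsFilZeroCoboundary.of_nsmul / of_zsmul` (abstract `PeriodRingData`, `char E = 0`): a cochain is a `Fil⁰`-coboundary as soon as a
  non-zero integer multiple of it is (the coboundaries form an `E`-subspace).
* §2 `smul_eq_of_zCoord_eq_algebraMap`: a point of `E₁(ℂ_F)` whose parameter lies in `F` is fixed by `Γ_F` (AEC VII.2.2: `z` is injective
  on `E₁`); `nsmul_divSeq`, `kummerO_nsmul`, `one_tmul_toRational_nsmul`: the division sequence `m • Q` of `m • Q₀` has Kummer element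
  `m • (σQₙ − Qₙ)ₙ` and cocycle `m •` the cocycle of `Q`.
* §3 ★ `isFilZeroCoboundary_kummerO_curveFO_of_coeffDisc`: ★★ for a base point `Q₀ ∈ E₁` with `𝒪_D`-RATIONAL parameter
  `z(Q₀) = c ∈ 𝔪_D` — the fixed lift is the constant point `AinfRamTop.coeffPt c`; no `u₀ / Q̂` hypothesis left.
* §4 ★★ `isFilZeroCoboundary_kummerO_curveFO_of_nsmul_of_coeffDisc` — THE INDEX STEP: for a `Γ_F`-fixed `Q₀ ∈ E(F̄)` (any point, not
  necessarily formal) and `m ≠ 0` with `m • Q₀ ∈ E₁` of `𝒪_D`-rational parameter, the cocycle of EVERY `p`-power division sequence `Q` of `Q₀`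
  is a `Fil⁰`-coboundary of `B_dR(F) ⊗ V_pE` (apply §3 to `m • Q`, divide by `m` with §1). With `m = [E(F) : E₁(F)]` (finite: AEC VII.2.1,
  VII.6.3) this is K1 for every point rational over `ℚ_p(ϖ) = 𝒪_D[1/p]` (whose formal multiples have parameter in `𝒪_{ℚ_p(ϖ)} = ℤ_p[ϖ] = 𝒪_D`,
  Serre, *Corps locaux* I §6 Prop. 17), granted (N1′), (Nη).
* §5 ★★★ `isFilZeroCoboundary_kummerO_explicitModel_of_nsmul_of_coeffDisc` — the same on the explicit good supersingular `𝒪_D`-models of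
  the K★ / TDS57 cells (`p ∈ {5, 7}`, `D = (X^e − p, ϖ)`, `W_D = ⟨0,0,0,aϱ^{r₄},bϱ^{r₆}⟩` under the (N1′) inequalities), with (N1′), (Nη) and
  (HT) DISCHARGED (`omegaPeriod_model_{five,seven}_ne_zero_of_lt`, `exists_etaPeriodHomO_not_mem_filOne`, Weil determinant): no period
  hypothesis, no matching hypothesis, no lift hypothesis — only the point data.

Crux K★ `stmt-BirchSwinnertonDyer-22226`, hT₂/K3 programme brick K1 (Bloch–Kato Example 3.11: `E(F) ⊗ ℚ_p → H¹(F, V_pE)` lands in the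
kernel of `H¹(F, V_pE) → H¹(F, B_dR⁺ ⊗ V_pE)`, cocycle level). BSD / K★ are not proved by any of this.

## References
* [BlochKato1990] S. Bloch, K. Kato, *L-functions and Tamagawa numbers of motives* (1990), Ex. 3.10.1, Example 3.11.
* [SilvermanAEC2009] J. H. Silverman, *AEC* (2009), Prop. VII.2.1–VII.2.2, VII.6.3, VIII.§2.
* [Kato1993LNM1553] K. Kato, LNM 1553 (1993), Ch. II §1.2.4, Lemma 1.4.3.
-/

noncomputable section

open scoped TensorProduct Classical

/-! ## §1 A cochain with a non-zero integer multiple which is a `Fil⁰`-coboundary is one -/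

namespace Literature.NumberTheory.GaloisRepresentations.PeriodRingData

universe u v v' w w'

section Abstract

variable {Γ : Type u} [Group Γ] [TopologicalSpace Γ] {P : Type v} {E : Type v'} [Field P]
  [TopologicalSpace P] [Field E] [Algebra P E]
  {M : Type w'} [AddCommGroup M] [Module P M] [TopologicalSpace M]
  {𝔅 : PeriodRingData.{u, v, v', w} Γ P E} {ρ : ContinuousRep Γ P M}

/-- **If `m • c` is a `Fil⁰`-coboundary for a natural number `m ≠ 0`, so is `c`** (`char E = 0`: divide the integrating element by `m`).
[cite: Kato1993LNM1553, Ch. II §1.2.4] -/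
theorem IsFilZeroCoboundary.of_nsmul [CharZero E] {m : ℕ} (hm : m ≠ 0) {c : Γ → 𝔅.B ⊗[P] M}
    (hc : 𝔅.IsFilZeroCoboundary ρ fun σ => m • c σ) : 𝔅.IsFilZeroCoboundary ρ c :=
  (hc.smul ((m : E)⁻¹)).congr fun σ => by
    rw [← Nat.cast_smul_eq_nsmul E m (c σ), smul_smul, inv_mul_cancel₀ (Nat.cast_ne_zero.2 hm), one_smul]

/-- **If `m • c` is a `Fil⁰`-coboundary for an integer `m ≠ 0`, so is `c`.** [cite: Kato1993LNM1553, Ch. II §1.2.4] -/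
theorem IsFilZeroCoboundary.of_zsmul [CharZero E] {m : ℤ} (hm : m ≠ 0) {c : Γ → 𝔅.B ⊗[P] M}
    (hc : 𝔅.IsFilZeroCoboundary ρ fun σ => m • c σ) : 𝔅.IsFilZeroCoboundary ρ c :=
  (hc.smul ((m : E)⁻¹)).congr fun σ => by
    rw [← Int.cast_smul_eq_zsmul E m (c σ), smul_smul, inv_mul_cancel₀ (Int.cast_ne_zero.2 hm), one_smul]

end Abstract

end Literature.NumberTheory.GaloisRepresentations.PeriodRingData

namespace Literature.NumberTheory.PAdicHodge

open Literature Literature.NumberTheory.GaloisRepresentations Literature.NumberTheory.EllipticCurves WeierstrassCurve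
open Literature.NumberTheory.GaloisRepresentations.IsNonarchimedeanLocalField Field ValuativeRel
open Literature.NumberTheory.GaloisRepresentations.LubinTate Literature.NumberTheory.EllipticCurves.FormalGroupChart

namespace AinfTop

/-! ## §2 Rational parameters; multiples of division sequences -/

section Rational

variable {F : Type} [Field F] [ValuativeRel F] [TopologicalSpace F] [IsNonarchimedeanLocalField F]
  (W : WeierstrassCurve (LTCoeff F))

/-- **A point of `E₁(ℂ_F)` (in `E(F̄)`) whose parameter `z` lies in `F` is fixed by `Γ_F`**: `σ` preserves `E₁`, acts on parameters
through its action on `ℂ_F`, fixes `F`, and `z` is injective on `E₁` (AEC VII.2.2). [cite: SilvermanAEC2009, Prop. VII.2.2] -/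
theorem smul_eq_of_zCoord_eq_algebraMap {P : (curveFO F W).geomPoints}
    (hP : geomToCO W P ∈ kernel (NormedField.valuation (K := CompletedAlgClosure F)) (curveOver (CompletedAlgClosure F) W))
    {x : F} (hx : (geomToCO W P).zCoord = algebraMap F (CompletedAlgClosure F) x) (σ : absoluteGaloisGroup F) : σ • P = P := by
  apply geomToCO_injective W
  rw [geomToCO_smul]
  have hσP : galPointCO W σ (geomToCO W P) ∈
      kernel (NormedField.valuation (K := CompletedAlgClosure F)) (curveOver (CompletedAlgClosure F) W) :=
    galPointHom_mem_kernel (CompletedAlgClosure.galRingHom σ) (galRingHom_cK_ltCoeff σ) (norm_galRingHom σ) (@hP)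
  refine eq_of_zCoord_eq (@hσP) (@hP) ?_
  have h := zCoord_galPointHom (W := W) (CompletedAlgClosure.galRingHom σ) (galRingHom_cK_ltCoeff σ) (geomToCO W P)
  change (galPointCO W σ (geomToCO W P)).zCoord = _ at h
  rw [h, hx, ← CompletedAlgClosure.smul_def, CompletedAlgClosure.smul_algebraMap]

end Rational

section MatchingO

variable {F : Type} [Field F] [ValuativeRel F] [TopologicalSpace F] [IsNonarchimedeanLocalField F] [CharZero F]
  {p : ℕ} [Fact p.Prime] [CharP 𝓀[F] p] {hp : valuation F p < 1} {D : EisensteinRoot F p hp}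
  (W : WeierstrassCurve (EisensteinRoot.CoeffDisc D)) (ψ : EisensteinRoot.CoeffDisc D →+* LTCoeff F)
  [(curveFO F (W.map ψ)).IsElliptic] [hE : (curveOver (CompletedAlgClosure F) (W.map ψ)).IsElliptic]

omit [CharP 𝓀[F] p] [(curveFO F (W.map ψ)).IsElliptic] hE in
/-- `m • Q` is a `p`-power division sequence when `Q` is. [cite: SilvermanAEC2009, VIII.§2] -/
theorem nsmul_divSeq {Q : ℕ → (curveFO F (W.map ψ)).geomPoints} (hQ : ∀ n, p • Q (n + 1) = Q n) (m n : ℕ) :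
    p • (m • Q (n + 1)) = m • Q n := by
  rw [smul_comm, hQ]

omit [CharP 𝓀[F] p] [(curveFO F (W.map ψ)).IsElliptic] hE in
/-- `m • Q₀` is `Γ_F`-fixed when `Q₀` is. [cite: SilvermanAEC2009, VIII.§2] -/
theorem smul_nsmul_eq_of_smul_eq {Q : ℕ → (curveFO F (W.map ψ)).geomPoints} (hfix : ∀ σ : absoluteGaloisGroup F, σ • Q 0 = Q 0)
    (m : ℕ) (σ : absoluteGaloisGroup F) : σ • (m • Q 0) = m • Q 0 := by
  have h : σ • (m • Q 0) = m • (σ • Q 0) := map_nsmul (DistribSMul.toAddMonoidHom _ σ) m (Q 0)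
  rw [h, hfix]

omit [CharP 𝓀[F] p] [(curveFO F (W.map ψ)).IsElliptic] hE in
/-- **The Kummer element of `m • Q` is `m •` the Kummer element of `Q`**: `(σ(mQₙ) − mQₙ)ₙ = m • (σQₙ − Qₙ)ₙ` in `T_pE(F̄)`.
[cite: SilvermanAEC2009, VIII.§2] -/
theorem kummerO_nsmul {Q : ℕ → (curveFO F (W.map ψ)).geomPoints} (hQ : ∀ n, p • Q (n + 1) = Q n)
    (hfix : ∀ σ : absoluteGaloisGroup F, σ • Q 0 = Q 0) (m : ℕ) (σ : absoluteGaloisGroup F) :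
    TateModule.mk (fun n => σ • (m • Q n) - m • Q n)
        (pow_smul_kummerO_eq_zero W ψ (Q := fun n => m • Q n) (nsmul_divSeq W ψ hQ m) (smul_nsmul_eq_of_smul_eq W ψ hfix m) σ)
        (smul_kummerO_succ W ψ (Q := fun n => m • Q n) (nsmul_divSeq W ψ hQ m) σ) =
      m • TateModule.mk (fun n => σ • Q n - Q n) (pow_smul_kummerO_eq_zero W ψ hQ hfix σ) (smul_kummerO_succ W ψ hQ σ) := by
  refine TateModule.ext fun n => ?_
  have h : σ • (m • Q n) = m • (σ • Q n) := map_nsmul (DistribSMul.toAddMonoidHom _ σ) m (Q n)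
  rw [map_nsmul, TateModule.proj_mk, TateModule.proj_mk, h, smul_sub]

omit [CharP 𝓀[F] p] [(curveFO F (W.map ψ)).IsElliptic] hE in
/-- `1 ⊗ (m • τ) = m • (1 ⊗ τ)` in `B_dR(F) ⊗ V_pE`. [cite: Kato1993LNM1553, Ch. II §1.2.4] -/
theorem one_tmul_toRational_nsmul [Fact (¬ IsUnit (p : integerC F))] [IsAdicComplete (Ideal.span {(p : integerC F)}) (integerC F)]
    [Algebra ℚ_[p] F] (m : ℕ) (τ : (curveFO F (W.map ψ)).tateModule p) :
    ((1 : (bdRPeriodRingData (F := F) (p := p) hp).B) ⊗ₜ[ℚ_[p]] TateModule.toRational p (m • τ) :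
        (bdRPeriodRingData (F := F) (p := p) hp).B ⊗[ℚ_[p]] (curveFO F (W.map ψ)).rationalTateModule p) =
      m • ((1 : (bdRPeriodRingData (F := F) (p := p) hp).B) ⊗ₜ[ℚ_[p]] TateModule.toRational p τ) := by
  rw [map_nsmul]
  exact map_nsmul ((TensorProduct.mk ℚ_[p] (bdRPeriodRingData (F := F) (p := p) hp).B ((curveFO F (W.map ψ)).rationalTateModule p))
    (1 : (bdRPeriodRingData (F := F) (p := p) hp).B)) m (TateModule.toRational p τ)

/-! ## §3 ★★ with the fixed lift supplied: `𝒪_D`-rational base parameter -/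

/-- ★ **K1 for the algebraic Kummer cocycle of a formal point with `𝒪_D`-rational parameter.** `W` over `𝒪_D`, `W♭ = W ⊗_ψ 𝒪_F` a good
model with supersingular reduction at the odd residue characteristic `p`, (N1′) and (Nη) for some Tate-module points; `Q` a `p`-power
division sequence in `E(F̄)` of a point `Q₀ ∈ E₁` with parameter `z(Q₀) = c ∈ 𝔪_D` (read in `F ⊆ ℂ_F`). Then `Q₀` is `Γ_F`-fixed and
`σ ↦ 1 ⊗ (σQₙ − Qₙ)ₙ` is a `Fil⁰`-coboundary of `B_dR(F) ⊗ V_pE` (★★ with the constant lift `AinfRamTop.coeffPt c`).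
[cite: BlochKato1990, Ex. 3.10.1, Example 3.11] [cite: SilvermanAEC2009, Prop. VII.2.2] -/
theorem isFilZeroCoboundary_kummerO_curveFO_of_coeffDisc
    [Fact (¬ IsUnit (p : integerC F))] [IsAdicComplete (Ideal.span {(p : integerC F)}) (integerC F)] [Algebra ℚ_[p] F]
    (hψ : ∀ c, algebraMap (LTCoeff F) F (ψ c) = EisensteinRoot.CoeffDisc.toF D c) (hp2 : p ≠ 2) (hΔ : IsUnit (W.map ψ).Δ)
    (hA : ((W.map ψ).map (redCoeff F)).hasseCoeff p = 0)
    (hN1 : ∃ τ : TatePtO F (W.map ψ) p, AinfRamTop.omegaPeriodHomO W ψ (surjective_fontaineTheta_integerC hp) hψ τ ≠ 0)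
    (hNη : ∃ τ : TatePtO F (W.map ψ) p,
      AinfRamTop.etaPeriodHomO W ψ (surjective_fontaineTheta_integerC hp) hψ τ ∉ (BdRPlusTop.filOne F p).toIdeal)
    {Q : ℕ → (curveFO F (W.map ψ)).geomPoints} (hQ : ∀ n, p • Q (n + 1) = Q n)
    (hQ0 : geomToCO (W.map ψ) (Q 0) ∈ kernel (NormedField.valuation (K := CompletedAlgClosure F)) (curveOver (CompletedAlgClosure F) (W.map ψ)))
    (c : EisensteinRoot.CoeffDisc D) (hc : ‖algebraMap F (CompletedAlgClosure F) (EisensteinRoot.CoeffDisc.toF D c)‖ < 1)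
    (hcQ : (geomToCO (W.map ψ) (Q 0)).zCoord = algebraMap F (CompletedAlgClosure F) (EisensteinRoot.CoeffDisc.toF D c)) :
    ∃ hfix : ∀ σ : absoluteGaloisGroup F, σ • Q 0 = Q 0,
      (bdRPeriodRingData (F := F) (p := p) hp).IsFilZeroCoboundary (rationalTateRep (curveFO F (W.map ψ)) p) fun σ =>
        ((1 : (bdRPeriodRingData (F := F) (p := p) hp).B) ⊗ₜ[ℚ_[p]]
          TateModule.toRational p (TateModule.mk (fun n => σ • Q n - Q n) (pow_smul_kummerO_eq_zero W ψ hQ hfix σ)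
            (smul_kummerO_succ W ψ hQ σ)) :
          (bdRPeriodRingData (F := F) (p := p) hp).B ⊗[ℚ_[p]] (curveFO F (W.map ψ)).rationalTateModule p) := by
  have hfix : ∀ σ : absoluteGaloisGroup F, σ • Q 0 = Q 0 := smul_eq_of_zCoord_eq_algebraMap (W.map ψ) hQ0 hcQ
  refine ⟨hfix, ?_⟩
  have hker := geomToCO_divSeq_mem_kernel (W.map ψ) hp2 hΔ hA hQ hQ0
  obtain ⟨x, rfl⟩ := (EisensteinRoot.CoeffDisc.of D).surjective c
  have hQhat : AinfRamTop.thetaPt W (surjective_fontaineTheta_integerC hp)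
      (AinfRamTop.coeffPt W (surjective_fontaineTheta_integerC hp) (EisensteinRoot.CoeffDisc.of D x) hc) =
      ⟨zPt (geomToCO (W.map ψ) (Q 0)) (hker 0)⟩ :=
    WeierstrassCurve.Pt.ext (Subtype.ext (Subtype.ext (by
      rw [AinfRamTop.coe_val_thetaPt_coeffPt, EisensteinRoot.coe_algebraMap_coeffDisc_cBall, coe_zPt, hcQ]; rfl)))
  exact isFilZeroCoboundary_kummerO_curveFO W ψ hψ hp2 hΔ hA hN1 hNη hQ hfix hQ0 (u₀ := zPt (geomToCO (W.map ψ) (Q 0)) (hker 0))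
    (coe_zPt _) hQhat fun σ => AinfRamTop.galPtN_coeffPt W σ _ hc

/-! ## §4 The index step: `m • Q₀ ∈ E₁` suffices -/

/-- ★★ **K1 for the algebraic Kummer cocycle of ANY `Γ_F`-fixed point a non-zero multiple of which is a formal point with `𝒪_D`-rational
parameter** (the index step `E(F) ⊋ E₁(F)`): `W`, `W♭`, (N1′), (Nη) as in ★; `Q` a `p`-power division sequence in `E(F̄)` of a `Γ_F`-fixed
`Q₀`; `m ≠ 0` with `m • Q₀ ∈ E₁` of parameter `z(m • Q₀) = c ∈ 𝔪_D`. Then `σ ↦ 1 ⊗ (σQₙ − Qₙ)ₙ` is a `Fil⁰`-coboundary of `B_dR(F) ⊗ V_pE`: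
★ for the division sequence `m • Q` of `m • Q₀`, whose cocycle is `m •` that of `Q` (`kummerO_nsmul`), and `IsFilZeroCoboundary.of_nsmul`.
[cite: BlochKato1990, Ex. 3.10.1, Example 3.11] [cite: SilvermanAEC2009, Prop. VII.2.1–VII.2.2 and VII.6.3] -/
theorem isFilZeroCoboundary_kummerO_curveFO_of_nsmul_of_coeffDisc
    [Fact (¬ IsUnit (p : integerC F))] [IsAdicComplete (Ideal.span {(p : integerC F)}) (integerC F)] [Algebra ℚ_[p] F]
    (hψ : ∀ c, algebraMap (LTCoeff F) F (ψ c) = EisensteinRoot.CoeffDisc.toF D c) (hp2 : p ≠ 2) (hΔ : IsUnit (W.map ψ).Δ)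
    (hA : ((W.map ψ).map (redCoeff F)).hasseCoeff p = 0)
    (hN1 : ∃ τ : TatePtO F (W.map ψ) p, AinfRamTop.omegaPeriodHomO W ψ (surjective_fontaineTheta_integerC hp) hψ τ ≠ 0)
    (hNη : ∃ τ : TatePtO F (W.map ψ) p,
      AinfRamTop.etaPeriodHomO W ψ (surjective_fontaineTheta_integerC hp) hψ τ ∉ (BdRPlusTop.filOne F p).toIdeal)
    {Q : ℕ → (curveFO F (W.map ψ)).geomPoints} (hQ : ∀ n, p • Q (n + 1) = Q n) (hfix : ∀ σ : absoluteGaloisGroup F, σ • Q 0 = Q 0)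
    {m : ℕ} (hm : m ≠ 0)
    (hQ0 : geomToCO (W.map ψ) (m • Q 0) ∈
      kernel (NormedField.valuation (K := CompletedAlgClosure F)) (curveOver (CompletedAlgClosure F) (W.map ψ)))
    (c : EisensteinRoot.CoeffDisc D) (hc : ‖algebraMap F (CompletedAlgClosure F) (EisensteinRoot.CoeffDisc.toF D c)‖ < 1)
    (hcQ : (geomToCO (W.map ψ) (m • Q 0)).zCoord = algebraMap F (CompletedAlgClosure F) (EisensteinRoot.CoeffDisc.toF D c)) :
    (bdRPeriodRingData (F := F) (p := p) hp).IsFilZeroCoboundary (rationalTateRep (curveFO F (W.map ψ)) p) fun σ =>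
      ((1 : (bdRPeriodRingData (F := F) (p := p) hp).B) ⊗ₜ[ℚ_[p]]
        TateModule.toRational p (TateModule.mk (fun n => σ • Q n - Q n) (pow_smul_kummerO_eq_zero W ψ hQ hfix σ)
          (smul_kummerO_succ W ψ hQ σ)) :
        (bdRPeriodRingData (F := F) (p := p) hp).B ⊗[ℚ_[p]] (curveFO F (W.map ψ)).rationalTateModule p) := by
  obtain ⟨_, h⟩ := isFilZeroCoboundary_kummerO_curveFO_of_coeffDisc W ψ hψ hp2 hΔ hA hN1 hNη (Q := fun n => m • Q n)
    (nsmul_divSeq W ψ hQ m) hQ0 c hc hcQ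
  refine PeriodRingData.IsFilZeroCoboundary.of_nsmul hm (h.congr fun σ => ?_)
  change ((1 : (bdRPeriodRingData (F := F) (p := p) hp).B) ⊗ₜ[ℚ_[p]] TateModule.toRational p
    (TateModule.mk (fun n => σ • (m • Q n) - m • Q n)
      (pow_smul_kummerO_eq_zero W ψ (Q := fun n => m • Q n) (nsmul_divSeq W ψ hQ m) (smul_nsmul_eq_of_smul_eq W ψ hfix m) σ)
      (smul_kummerO_succ W ψ (Q := fun n => m • Q n) (nsmul_divSeq W ψ hQ m) σ)) : _ ⊗[ℚ_[p]] _) = _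
  rw [kummerO_nsmul W ψ hQ hfix m σ, one_tmul_toRational_nsmul W ψ]

end MatchingO

/-! ## §5 The explicit supersingular cell models: only the point data left -/

section Cells

variable {F : Type} [Field F] [ValuativeRel F] [TopologicalSpace F] [IsNonarchimedeanLocalField F] [CharZero F]
  {p : ℕ} [Fact p.Prime] [Fact (¬ IsUnit (p : integerC F))] [IsAdicComplete (Ideal.span {(p : integerC F)}) (integerC F)]
  (hp : valuation F p < 1) [Algebra ℚ_[p] F]

/-- ★★★ **K1 for the explicit good supersingular `𝒪_D`-models of the K★ / TDS57 cells, in the Kummer theory of `E`, with every period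
hypothesis discharged.** `D = (X^e − p, ϖ)` an Eisenstein datum of the `p`-adic field `F` (`p ∈ {5, 7}`), `W_D = ⟨0, 0, 0, a ϱ^{r₄}, b ϱ^{r₆}⟩`
over `𝒪_D` with `3r₄ = e t₄`, `2r₆ = e t₆`, `64a³p^{t₄} + 432b²p^{t₆} ∈ ℤ_pˣ` and the (N1′) inequalities (`0 < r₄`, `e < 9`, `e < r₄ + 4` at `5`;
`0 < r₆`, `e < 13`, `e < r₆ + 6` at `7`), `ψ : 𝒪_D → 𝒪_F` the coefficient map, `E = curveFO F (W_D ⊗_ψ 𝒪_F)`. For a `p`-power division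
sequence `Q` in `E(F̄)` of a `Γ_F`-fixed `Q₀` and `m ≠ 0` with `m • Q₀ ∈ E₁` of `𝒪_D`-rational parameter `c`, the algebraic Kummer cocycle
`σ ↦ 1 ⊗ (σQₙ − Qₙ)ₙ` is a `Fil⁰`-coboundary of `B_dR(F) ⊗ V_pE` — (N1′) by `omegaPeriod_model_{five,seven}_ne_zero_of_lt`, (Nη) by
`exists_etaPeriodHomO_not_mem_filOne` at the witness `‖p‖ < ‖τ₁‖^p`, (HT) by the Weil determinant, the matching canonical.
[cite: BlochKato1990, Ex. 3.10.1, Example 3.11] [cite: SilvermanAEC2009, IV.7.5, VII.2.1–VII.2.2] [cite: Tate1967, §4 Cor. 2] -/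
theorem isFilZeroCoboundary_kummerO_explicitModel_of_nsmul_of_coeffDisc (D : EisensteinRoot F p hp) {e : ℕ}
    (hD : D.poly = Polynomial.X ^ e - Polynomial.C (p : ℤ_[p])) (a b : ℤ_[p]) (r₄ r₆ t₄ t₆ : ℕ) (hp57 : p = 5 ∨ p = 7)
    (h5 : p = 5 → 0 < r₄ ∧ e < 9 ∧ e < r₄ + 4) (h7 : p = 7 → 0 < r₆ ∧ e < 13 ∧ e < r₆ + 6)
    (h₄ : 3 * r₄ = e * t₄) (h₆ : 2 * r₆ = e * t₆) (hu : IsUnit (64 * a ^ 3 * (p : ℤ_[p]) ^ t₄ + 432 * b ^ 2 * (p : ℤ_[p]) ^ t₆))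
    (ψ : EisensteinRoot.CoeffDisc D →+* LTCoeff F) (hψ : ∀ c, algebraMap (LTCoeff F) F (ψ c) = EisensteinRoot.CoeffDisc.toF D c)
    [(curveFO F ((((⟨0, 0, 0, AdjoinRoot.of D.poly a * AdjoinRoot.root D.poly ^ r₄,
      AdjoinRoot.of D.poly b * AdjoinRoot.root D.poly ^ r₆⟩ : WeierstrassCurve D.Coeff).map
      (EisensteinRoot.CoeffDisc.of D).toRingHom)).map ψ)).IsElliptic]
    [(curveOver (CompletedAlgClosure F) ((((⟨0, 0, 0, AdjoinRoot.of D.poly a * AdjoinRoot.root D.poly ^ r₄,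
      AdjoinRoot.of D.poly b * AdjoinRoot.root D.poly ^ r₆⟩ : WeierstrassCurve D.Coeff).map
      (EisensteinRoot.CoeffDisc.of D).toRingHom)).map ψ)).IsElliptic]
    {Q : ℕ → (curveFO F ((((⟨0, 0, 0, AdjoinRoot.of D.poly a * AdjoinRoot.root D.poly ^ r₄,
      AdjoinRoot.of D.poly b * AdjoinRoot.root D.poly ^ r₆⟩ : WeierstrassCurve D.Coeff).map
      (EisensteinRoot.CoeffDisc.of D).toRingHom)).map ψ)).geomPoints}
    (hQ : ∀ n, p • Q (n + 1) = Q n) (hfix : ∀ σ : absoluteGaloisGroup F, σ • Q 0 = Q 0) {m : ℕ} (hm : m ≠ 0)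
    (hQ0 : geomToCO _ (m • Q 0) ∈ kernel (NormedField.valuation (K := CompletedAlgClosure F))
      (curveOver (CompletedAlgClosure F) ((((⟨0, 0, 0, AdjoinRoot.of D.poly a * AdjoinRoot.root D.poly ^ r₄,
        AdjoinRoot.of D.poly b * AdjoinRoot.root D.poly ^ r₆⟩ : WeierstrassCurve D.Coeff).map
        (EisensteinRoot.CoeffDisc.of D).toRingHom)).map ψ)))
    (c : EisensteinRoot.CoeffDisc D) (hc : ‖algebraMap F (CompletedAlgClosure F) (EisensteinRoot.CoeffDisc.toF D c)‖ < 1)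
    (hcQ : (geomToCO _ (m • Q 0)).zCoord = algebraMap F (CompletedAlgClosure F) (EisensteinRoot.CoeffDisc.toF D c)) :
    (bdRPeriodRingData (F := F) (p := p) hp).IsFilZeroCoboundary
      (rationalTateRep (curveFO F ((((⟨0, 0, 0, AdjoinRoot.of D.poly a * AdjoinRoot.root D.poly ^ r₄,
        AdjoinRoot.of D.poly b * AdjoinRoot.root D.poly ^ r₆⟩ : WeierstrassCurve D.Coeff).map
        (EisensteinRoot.CoeffDisc.of D).toRingHom)).map ψ)) p) fun σ =>
      ((1 : (bdRPeriodRingData (F := F) (p := p) hp).B) ⊗ₜ[ℚ_[p]]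
        TateModule.toRational p (TateModule.mk (fun n => σ • Q n - Q n)
          (pow_smul_kummerO_eq_zero (hp := hp) _ ψ hQ hfix σ) (smul_kummerO_succ (hp := hp) _ ψ hQ σ)) :
        (bdRPeriodRingData (F := F) (p := p) hp).B ⊗[ℚ_[p]] (curveFO F ((((⟨0, 0, 0, AdjoinRoot.of D.poly a * AdjoinRoot.root D.poly ^ r₄,
          AdjoinRoot.of D.poly b * AdjoinRoot.root D.poly ^ r₆⟩ : WeierstrassCurve D.Coeff).map
          (EisensteinRoot.CoeffDisc.of D).toRingHom)).map ψ)).rationalTateModule p) := by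
  have hθ : Function.Surjective (WittVector.fontaineTheta (integerC F) p) := surjective_fontaineTheta_integerC hp
  have hp2 : p ≠ 2 := by rcases hp57 with rfl | rfl <;> norm_num
  have hr₄ : p = 5 → 0 < r₄ := fun h => (h5 h).1
  have hr₆ : p = 7 → 0 < r₆ := fun h => (h7 h).1
  -- the residue characteristic
  haveI : CharP 𝓀[F] p := by
    refine (CharP.charP_iff_prime_eq_zero Fact.out).2 ?_
    rw [← map_natCast (IsLocalRing.residue 𝒪[F]), IsLocalRing.residue_eq_zero_iff, IsLocalRing.mem_maximalIdeal,
      mem_nonunits_iff, (Valuation.integer.integers (valuation F)).isUnit_iff_valuation_eq_one]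
    rw [map_natCast]
    exact hp.ne
  -- the reduction data of `W♭ = W_D ⊗_β 𝒪_F`, `β = ψ ∘ of`, and the Tate-module witness
  have hΔ := isUnit_Δ_map_model (F := F) hD (ψ.comp (EisensteinRoot.CoeffDisc.of D).toRingHom) a b h₄ h₆ hu
  have hA := hasseCoeff_red_map_model_eq_zero hD (ψ.comp (EisensteinRoot.CoeffDisc.of D).toRingHom) a b hp57 hr₄ hr₆
  obtain ⟨τ, hτ1, hτp⟩ :=
    exists_tatePtO_norm_p_lt_norm_pow_model hD (ψ.comp (EisensteinRoot.CoeffDisc.of D).toRingHom) a b hp57 h₄ h₆ hu hr₄ hr₆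
  -- (N1′) in inequality form
  have hN1seq : ∀ {t : ℕ → (maxNilIdealC F).toIdeal} (ht0 : (t 0 : CBall F) = 0)
      (htp : ∀ n, AinfRamTop.mulPC (((⟨0, 0, 0, AdjoinRoot.of D.poly a * AdjoinRoot.root D.poly ^ r₄,
        AdjoinRoot.of D.poly b * AdjoinRoot.root D.poly ^ r₆⟩ : WeierstrassCurve D.Coeff).map
        (EisensteinRoot.CoeffDisc.of D).toRingHom)) (t (n + 1)) = t n),
      (t 1 : CBall F) ≠ 0 → AinfRamTop.omegaPeriod _ hθ t ht0 htp ≠ 0 := by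
    intro t ht0 htp h1
    rcases hp57 with rfl | rfl
    · obtain ⟨hr, he9, her⟩ := h5 rfl
      exact AinfRamTop.omegaPeriod_model_five_ne_zero_of_lt hD a b hr he9 her h₄ h₆ hu ht0 htp h1
    · obtain ⟨hr, he13, her⟩ := h7 rfl
      exact AinfRamTop.omegaPeriod_model_seven_ne_zero_of_lt hD a b hr he13 her h₄ h₆ hu ht0 htp h1
  have hN1 := AinfRamTop.exists_omegaPeriodHomO_ne_zero _ ψ (hθ := hθ) (hψ := hψ) hN1seq ⟨τ, hτ1⟩
  -- (Nη)
  have hNη := AinfRamTop.exists_etaPeriodHomO_not_mem_filOne (hθ := hθ)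
    (((⟨0, 0, 0, AdjoinRoot.of D.poly a * AdjoinRoot.root D.poly ^ r₄, AdjoinRoot.of D.poly b * AdjoinRoot.root D.poly ^ r₆⟩ :
      WeierstrassCurve D.Coeff).map (EisensteinRoot.CoeffDisc.of D).toRingHom)) ψ hψ hp2 hΔ hA ⟨τ, hτp⟩
  exact isFilZeroCoboundary_kummerO_curveFO_of_nsmul_of_coeffDisc
    (((⟨0, 0, 0, AdjoinRoot.of D.poly a * AdjoinRoot.root D.poly ^ r₄, AdjoinRoot.of D.poly b * AdjoinRoot.root D.poly ^ r₆⟩ :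
      WeierstrassCurve D.Coeff).map (EisensteinRoot.CoeffDisc.of D).toRingHom)) ψ hψ hp2 hΔ hA hN1 hNη hQ hfix hm hQ0 c hc hcQ

end Cells

end AinfTop

end Literature.NumberTheory.PAdicHodge

end
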